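import Summits.Parity.GeneralizedHardyLittlewood.Theorems.FordMaynardSieveConst01651SieveConst01651PairingTwoSplit
import Literature.NumberTheory.Sieve.FordMaynardSliceBlocks
import HarnessLib

/-!
# Route `FordMaynardSieveConst01651`, target `SieveConst01651` (stmt-Parity-19185), stub `stub_certValuePos` (R2):
# the `r = 2` pairing as a sum of entry pairings

Def-free helper file (step (3) of the `certP`/`certN` soundness, see `…CertAssembly`).  With
`T_e(t) = ∫_{u∈(0,t)} (c_e/10⁶)𝟙_{P_e}(t,u)/(u(t−u)) du` (the cell term of `…PairingTwoSplit`):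

  `I₂ = ∫_{(0,1/2]} S⁰_2(t) Φ₆(1−t) dt = Σ_{e ∈ certG2} ∫_{(0,1/2]} T_e(t) Φ₆(1−t) dt`   (`pairing_two_eq_entry_sum`).

Ingredients: `sliceFnOrd_two_eq_entry_sum` (a.e. in `t`), the joint measurability of the cell term
(`measurable_entryKernel`), the measurability and boundedness of `T_e` (`measurable_entryTerm`, `abs_entryTerm_le`), and
`integral_list_sum_of_integrable`.

References: [FordMaynard2024PrimeSieves] arXiv:2407.14368, §8.2.
-/

noncomputable section

open MeasureTheory Set
open scoped Classical
open Literature.NumberTheory.Sieve Literature.NumberTheory.Sieve.FordMaynard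
open Literature.Analysis.Convolution

namespace Summit.Parity.GeneralizedHardyLittlewood.FordMaynardSieveConst01651SieveConst01651

/-- Joint measurability in `(t, u)` of the cell kernel `𝟙_{(0,t)}(u)·𝟙_{P_e}(t,u)/(u(t−u))`. [folklore] -/
theorem measurable_entryKernel (e : ℕ × ℕ × ℕ × ℤ) :
    Measurable fun p : ℝ × ℝ => (Set.Ioo 0 p.1).indicator (fun u : ℝ =>
      if ((certEdge e.1 : ℚ) : ℝ) < u ∧ u < ((certEdge (e.1 + 1) : ℚ) : ℝ) ∧
          ((certEdge e.2.1 : ℚ) : ℝ) < p.1 - u ∧ p.1 - u < ((certEdge (e.2.1 + 1) : ℚ) : ℝ) ∧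
          u ≤ p.1 - u ∧ (if e.2.2.1 = 0 then p.1 < 8349 / 20000 else 8349 / 20000 < p.1) ∧ p.1 < 1 / 2
        then 1 / (u * (p.1 - u)) else 0) p.2 := by
  have ht : Measurable fun p : ℝ × ℝ => p.1 := measurable_fst
  have hu : Measurable fun p : ℝ × ℝ => p.2 := measurable_snd
  have htu : Measurable fun p : ℝ × ℝ => p.1 - p.2 := measurable_fst.sub measurable_snd
  -- rewrite the indicator as one `ite` on a measurable set of pairs
  have heq : (fun p : ℝ × ℝ => (Set.Ioo 0 p.1).indicator (fun u : ℝ =>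
      if ((certEdge e.1 : ℚ) : ℝ) < u ∧ u < ((certEdge (e.1 + 1) : ℚ) : ℝ) ∧
          ((certEdge e.2.1 : ℚ) : ℝ) < p.1 - u ∧ p.1 - u < ((certEdge (e.2.1 + 1) : ℚ) : ℝ) ∧
          u ≤ p.1 - u ∧ (if e.2.2.1 = 0 then p.1 < 8349 / 20000 else 8349 / 20000 < p.1) ∧ p.1 < 1 / 2
        then 1 / (u * (p.1 - u)) else 0) p.2) =
      fun p : ℝ × ℝ => if (0 < p.2 ∧ p.2 < p.1) ∧ (((certEdge e.1 : ℚ) : ℝ) < p.2 ∧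
          p.2 < ((certEdge (e.1 + 1) : ℚ) : ℝ) ∧ ((certEdge e.2.1 : ℚ) : ℝ) < p.1 - p.2 ∧
          p.1 - p.2 < ((certEdge (e.2.1 + 1) : ℚ) : ℝ) ∧ p.2 ≤ p.1 - p.2 ∧
          (if e.2.2.1 = 0 then p.1 < 8349 / 20000 else 8349 / 20000 < p.1) ∧ p.1 < 1 / 2)
        then 1 / (p.2 * (p.1 - p.2)) else 0 := by
    funext p
    simp only [Set.indicator, Set.mem_Ioo]
    by_cases h1 : 0 < p.2 ∧ p.2 < p.1
    · rw [if_pos h1]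
      by_cases h2 : ((certEdge e.1 : ℚ) : ℝ) < p.2 ∧ p.2 < ((certEdge (e.1 + 1) : ℚ) : ℝ) ∧
          ((certEdge e.2.1 : ℚ) : ℝ) < p.1 - p.2 ∧ p.1 - p.2 < ((certEdge (e.2.1 + 1) : ℚ) : ℝ) ∧
          p.2 ≤ p.1 - p.2 ∧ (if e.2.2.1 = 0 then p.1 < 8349 / 20000 else 8349 / 20000 < p.1) ∧ p.1 < 1 / 2
      · rw [if_pos h2, if_pos ⟨h1, h2⟩]
      · rw [if_neg h2, if_neg (fun h => h2 h.2)]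
    · rw [if_neg h1, if_neg (fun h => h1 h.1)]
  rw [heq]
  refine Measurable.ite ?_ ((measurable_const.div (hu.mul htu))) measurable_const
  have hb : MeasurableSet {p : ℝ × ℝ | (if e.2.2.1 = 0 then p.1 < 8349 / 20000 else 8349 / 20000 < p.1)} := by
    by_cases hj : e.2.2.1 = 0
    · simp only [hj, if_true]; exact measurableSet_lt ht measurable_const
    · simp only [hj, if_false]; exact measurableSet_lt measurable_const ht
  exact ((measurableSet_lt measurable_const hu).inter (measurableSet_lt hu ht)).inter
    ((measurableSet_lt measurable_const hu).inter ((measurableSet_lt hu measurable_const).inter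
    ((measurableSet_lt measurable_const htu).inter ((measurableSet_lt htu measurable_const).inter
    ((measurableSet_le hu htu).inter (hb.inter (measurableSet_lt ht measurable_const)))))))

/-- **`t ↦ T_e(t)` is measurable** (parametric integral of a jointly measurable kernel). [folklore] -/
theorem measurable_entryTerm (e : ℕ × ℕ × ℕ × ℤ) (κ : ℝ) :
    Measurable fun t : ℝ => ∫ u in Set.Ioo 0 t, κ *
      (if ((certEdge e.1 : ℚ) : ℝ) < u ∧ u < ((certEdge (e.1 + 1) : ℚ) : ℝ) ∧
          ((certEdge e.2.1 : ℚ) : ℝ) < t - u ∧ t - u < ((certEdge (e.2.1 + 1) : ℚ) : ℝ) ∧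
          u ≤ t - u ∧ (if e.2.2.1 = 0 then t < 8349 / 20000 else 8349 / 20000 < t) ∧ t < 1 / 2
        then 1 / (u * (t - u)) else 0) := by
  have hK : Measurable fun p : ℝ × ℝ => κ * (Set.Ioo 0 p.1).indicator (fun u : ℝ =>
      if ((certEdge e.1 : ℚ) : ℝ) < u ∧ u < ((certEdge (e.1 + 1) : ℚ) : ℝ) ∧
          ((certEdge e.2.1 : ℚ) : ℝ) < p.1 - u ∧ p.1 - u < ((certEdge (e.2.1 + 1) : ℚ) : ℝ) ∧
          u ≤ p.1 - u ∧ (if e.2.2.1 = 0 then p.1 < 8349 / 20000 else 8349 / 20000 < p.1) ∧ p.1 < 1 / 2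
        then 1 / (u * (p.1 - u)) else 0) p.2 := measurable_const.mul (measurable_entryKernel e)
  have hsm := (hK.stronglyMeasurable.integral_prod_right' (ν := (volume : Measure ℝ))).measurable
  have heq : (fun t : ℝ => ∫ u in Set.Ioo 0 t, κ *
      (if ((certEdge e.1 : ℚ) : ℝ) < u ∧ u < ((certEdge (e.1 + 1) : ℚ) : ℝ) ∧
          ((certEdge e.2.1 : ℚ) : ℝ) < t - u ∧ t - u < ((certEdge (e.2.1 + 1) : ℚ) : ℝ) ∧
          u ≤ t - u ∧ (if e.2.2.1 = 0 then t < 8349 / 20000 else 8349 / 20000 < t) ∧ t < 1 / 2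
        then 1 / (u * (t - u)) else 0)) =
      fun t : ℝ => ∫ u, κ * (Set.Ioo 0 t).indicator (fun u : ℝ =>
      if ((certEdge e.1 : ℚ) : ℝ) < u ∧ u < ((certEdge (e.1 + 1) : ℚ) : ℝ) ∧
          ((certEdge e.2.1 : ℚ) : ℝ) < t - u ∧ t - u < ((certEdge (e.2.1 + 1) : ℚ) : ℝ) ∧
          u ≤ t - u ∧ (if e.2.2.1 = 0 then t < 8349 / 20000 else 8349 / 20000 < t) ∧ t < 1 / 2
        then 1 / (u * (t - u)) else 0) u := by
    funext t
    rw [← integral_indicator measurableSet_Ioo]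
    refine integral_congr_ae (Filter.Eventually.of_forall fun u => ?_)
    by_cases hu : u ∈ Set.Ioo 0 t
    · simp only [Set.indicator_of_mem hu]
    · simp only [Set.indicator_of_notMem hu, mul_zero]
  rw [heq]
  exact hsm

/-- **`|T_e(t)| ≤ (|c_e|/10⁶)/ν₀² · (1/2)`** for `t ≤ 1/2` (the kernel is bounded by `1/ν₀²` on `(0,t)`). [folklore] -/
theorem abs_entryTerm_le (e : ℕ × ℕ × ℕ × ℤ) (κ : ℝ) {t : ℝ} (ht0 : 0 ≤ t) (ht : t ≤ 1 / 2) :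
    |∫ u in Set.Ioo 0 t, κ *
      (if ((certEdge e.1 : ℚ) : ℝ) < u ∧ u < ((certEdge (e.1 + 1) : ℚ) : ℝ) ∧
          ((certEdge e.2.1 : ℚ) : ℝ) < t - u ∧ t - u < ((certEdge (e.2.1 + 1) : ℚ) : ℝ) ∧
          u ≤ t - u ∧ (if e.2.2.1 = 0 then t < 8349 / 20000 else 8349 / 20000 < t) ∧ t < 1 / 2
        then 1 / (u * (t - u)) else 0)| ≤ |κ| * (1 / (1651 / 10000) ^ 2) * (1 / 2) := by
  have hν : (0 : ℝ) < 1651 / 10000 := by norm_num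
  have hbound : ∀ u ∈ Set.Ioo 0 t, ‖κ *
      (if ((certEdge e.1 : ℚ) : ℝ) < u ∧ u < ((certEdge (e.1 + 1) : ℚ) : ℝ) ∧
          ((certEdge e.2.1 : ℚ) : ℝ) < t - u ∧ t - u < ((certEdge (e.2.1 + 1) : ℚ) : ℝ) ∧
          u ≤ t - u ∧ (if e.2.2.1 = 0 then t < 8349 / 20000 else 8349 / 20000 < t) ∧ t < 1 / 2
        then 1 / (u * (t - u)) else 0)‖ ≤ |κ| * (1 / (1651 / 10000) ^ 2) := by
    intro u _
    rw [Real.norm_eq_abs, abs_mul]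
    refine mul_le_mul_of_nonneg_left ?_ (abs_nonneg _)
    by_cases h : ((certEdge e.1 : ℚ) : ℝ) < u ∧ u < ((certEdge (e.1 + 1) : ℚ) : ℝ) ∧
        ((certEdge e.2.1 : ℚ) : ℝ) < t - u ∧ t - u < ((certEdge (e.2.1 + 1) : ℚ) : ℝ) ∧
        u ≤ t - u ∧ (if e.2.2.1 = 0 then t < 8349 / 20000 else 8349 / 20000 < t) ∧ t < 1 / 2
    · rw [if_pos h]
      have hu : (1651 / 10000 : ℝ) < u := lt_of_le_of_lt (nu_le_certEdge _) h.1
      have htu : (1651 / 10000 : ℝ) < t - u := lt_of_le_of_lt (nu_le_certEdge _) h.2.2.1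
      have hpos : 0 < u * (t - u) := mul_pos (hν.trans hu) (hν.trans htu)
      rw [abs_of_pos (one_div_pos.2 hpos), one_div_le_one_div hpos (by positivity), sq]
      exact mul_le_mul hu.le htu.le hν.le (hν.trans hu).le
    · rw [if_neg h, abs_zero]; positivity
  have h := norm_setIntegral_le_of_norm_le_const (measure_Ioo_lt_top : volume (Set.Ioo (0 : ℝ) t) < ⊤) hbound
  rw [Real.norm_eq_abs, Real.volume_real_Ioo_of_le ht0] at h
  refine h.trans ?_
  refine mul_le_mul_of_nonneg_left (by linarith) (by positivity)

/-- **The `r = 2` pairing as a sum of entry pairings.** [cite: FordMaynard2024PrimeSieves, §8.2] -/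
theorem pairing_two_eq_entry_sum :
    ∫ t in Set.Ioc 0 (1 / 2), sliceIntegral 2 t
        (fun v => if (∀ i, (1651 / 10000 : ℝ) < v i) ∧ Monotone v then coneCert 2 v / ∏ i, v i else 0) *
      ∑ m ∈ Finset.Icc 1 6, (1 / (m.factorial : ℝ)) *
        cpow (fun t : ℝ => if (1651 / 10000 : ℝ) < t then 1 / t else 0) m (1 - t) =
    (certG2.map fun e => ∫ t in Set.Ioc 0 (1 / 2), (∫ u in Set.Ioo 0 t, ((e.2.2.2 : ℤ) : ℝ) / 1000000 *
        (if ((certEdge e.1 : ℚ) : ℝ) < u ∧ u < ((certEdge (e.1 + 1) : ℚ) : ℝ) ∧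
            ((certEdge e.2.1 : ℚ) : ℝ) < t - u ∧ t - u < ((certEdge (e.2.1 + 1) : ℚ) : ℝ) ∧
            u ≤ t - u ∧ (if e.2.2.1 = 0 then t < 8349 / 20000 else 8349 / 20000 < t) ∧ t < 1 / 2
          then 1 / (u * (t - u)) else 0)) *
      ∑ m ∈ Finset.Icc 1 6, (1 / (m.factorial : ℝ)) *
        cpow (fun t : ℝ => if (1651 / 10000 : ℝ) < t then 1 / t else 0) m (1 - t)).sum := by
  have hν : (0 : ℝ) < 1651 / 10000 := by norm_num
  set Φ : ℝ → ℝ := fun x => ∑ m ∈ Finset.Icc 1 6, (1 / (m.factorial : ℝ)) *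
    cpow (fun t : ℝ => if (1651 / 10000 : ℝ) < t then 1 / t else 0) m x with hΦ
  have hΦb : LocBdd Φ := locBdd_buchstabPhi hν 6
  -- a.e. in t: the slice function is the entry sum
  have hN : ({(8349 / 20000 : ℝ), 1 / 2} : Set ℝ).Finite := by simp
  have hae : ∀ᵐ t ∂(volume.restrict (Set.Ioc (0 : ℝ) (1 / 2))), sliceIntegral 2 t
      (fun v => if (∀ i, (1651 / 10000 : ℝ) < v i) ∧ Monotone v then coneCert 2 v / ∏ i, v i else 0) * Φ (1 - t) =
      (certG2.map fun e => (∫ u in Set.Ioo 0 t, ((e.2.2.2 : ℤ) : ℝ) / 1000000 *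
        (if ((certEdge e.1 : ℚ) : ℝ) < u ∧ u < ((certEdge (e.1 + 1) : ℚ) : ℝ) ∧
            ((certEdge e.2.1 : ℚ) : ℝ) < t - u ∧ t - u < ((certEdge (e.2.1 + 1) : ℚ) : ℝ) ∧
            u ≤ t - u ∧ (if e.2.2.1 = 0 then t < 8349 / 20000 else 8349 / 20000 < t) ∧ t < 1 / 2
          then 1 / (u * (t - u)) else 0)) * Φ (1 - t)).sum := by
    filter_upwards [ae_restrict_of_ae (hN.countable.ae_notMem (volume : Measure ℝ))] with t ht
    simp only [Set.mem_insert_iff, Set.mem_singleton_iff, not_or] at ht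
    rw [sliceFnOrd_two_eq_entry_sum ht.1 ht.2, List.sum_map_mul_right]
  rw [integral_congr_ae hae]
  -- integrability of each entry pairing on `(0, 1/2]`
  obtain ⟨C, hC⟩ := hΦb.bdd 1
  have hint : ∀ e ∈ certG2, Integrable (fun t => (∫ u in Set.Ioo 0 t, ((e.2.2.2 : ℤ) : ℝ) / 1000000 *
        (if ((certEdge e.1 : ℚ) : ℝ) < u ∧ u < ((certEdge (e.1 + 1) : ℚ) : ℝ) ∧
            ((certEdge e.2.1 : ℚ) : ℝ) < t - u ∧ t - u < ((certEdge (e.2.1 + 1) : ℚ) : ℝ) ∧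
            u ≤ t - u ∧ (if e.2.2.1 = 0 then t < 8349 / 20000 else 8349 / 20000 < t) ∧ t < 1 / 2
          then 1 / (u * (t - u)) else 0)) * Φ (1 - t)) (volume.restrict (Set.Ioc (0 : ℝ) (1 / 2))) := by
    intro e _
    have hm := (measurable_entryTerm e (((e.2.2.2 : ℤ) : ℝ) / 1000000)).mul
      (hΦb.measurable.comp (measurable_id.const_sub (1 : ℝ)))
    refine Measure.integrableOn_of_bounded (M := |((e.2.2.2 : ℤ) : ℝ) / 1000000| * (1 / (1651 / 10000) ^ 2) *
      (1 / 2) * C) measure_Ioc_lt_top.ne hm.aestronglyMeasurable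
      ((ae_restrict_iff' measurableSet_Ioc).2 (Filter.Eventually.of_forall fun t htI => ?_))
    rw [Real.norm_eq_abs, abs_mul]
    have h1 := abs_entryTerm_le e (((e.2.2.2 : ℤ) : ℝ) / 1000000) htI.1.le htI.2
    have h2 : |Φ (1 - t)| ≤ C := hC _ (by rw [abs_le]; constructor <;> linarith [htI.1, htI.2])
    exact mul_le_mul h1 h2 (abs_nonneg _) (by positivity)
  exact (integral_list_sum_of_integrable (μ := volume.restrict (Set.Ioc (0 : ℝ) (1 / 2))) _ certG2 hint).1

end Summit.Parity.GeneralizedHardyLittlewood.FordMaynardSieveConst01651SieveConst01651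

end
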